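import Literature.NumberTheory.Automorphic.UnitaryThreeRamifiedTorusDoubleCosetsHK     -- ★ γ2′ hA′ PART 2 p841830 (+ PART 1 p841802, hA, bridge, γ0, DEFS)
import HarnessLib

/-!
# Mars' lemma for the RAMIFIED order `𝒪_F[√π₀]`, read in `K` — `M₂(𝒪_F) ∩ GL₂(F) = ⋃_i ι(L^×)·diag(1, π₀^i)·GL₂(𝒪_F)` — and Flicker's Prop. 6 (a) for the
# type-(2) torus with the Mars binder DISCHARGED
(Flicker (1998), *Elementary proof of the fundamental lemma for a unitary group*, Prop. 6 (second half) p. 83 «`GL(2,F) = ⋃_j T₁ r_j K`, `T₁ ∋ u + v w`,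
`w² = π`» — proof: «let `z ∈ gR²` be of minimal valuation; then `z⁻¹gR² = R + π^j√π R`»)

Topic `NumberTheory/Automorphic`; namespace `Literature.NumberTheory.Automorphic.UnitaryGroup`.  KERNEL mathematics only: theorems, no definition, no
named fact, no instance, no notation, no `sorry`.  Cell `pub/hodgecm-mathlib`, programme P3a, road «D-N7-inert», MAP v3 «N7-ns COUNT FROM FLICKER», brick
γ2′ «THE RAMIFIED ∕ TYPE-(2) TRANSPORT» — FILE `hA′` PART 3: the named residual `hMars` of ★ PART 2 (`exists_mem_centralizer_mul_ramifiedRep_mul_mem_flickerKH`),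
of ★ B-p04 (g33) C9-θ′ and of ★ A-p03 (g24) p841886, DISCHARGED by an elementary `K`-side argument (no ring of integers of `L = F(√π₀)`, no `AdjoinRoot`).
HC_CM is proved only modulo the printed citations (2 remaining named inputs hLiu418, h413) until rung 0 closes; this file discharges no named fact.

MATHEMATICS.  `|π₀| = |ϖ|` (odd).  For `x, y ∈ K`: **`|x² − π₀y²| = max(|x|², |π₀||y|²)`** (the two valuations have different parity), so `N(x,y) := x² − π₀y²`
vanishes only at `(0,0)` and `|x|², |π₀||y|² ≤ |N(x,y)|`.  Given `g = (a b; c e) ∈ M₂(𝒪_F)` with `ae − bc ≠ 0`, read the columns as `z₀ = a + c√π₀`,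
`z₁ = b + e√π₀`; say `|N(z₁)| ≤ |N(z₀)|`.  Then `w := z₁∕z₀ = x₁ + y₁√π₀` with `x₁ = (ab − π₀ce)∕N(z₀)`, `y₁ = (ae − bc)∕N(z₀)`, and BRAHMAGUPTA
`N(w) = N(z₁)∕N(z₀)` gives `|x₁| ≤ 1`, `|y₁| ≤ 1`, `y₁ = π₀^i η`, `|η| = 1`; hence `g = ι(z₀)·diag(1, π₀^i)·(1, x₁; 0, η)`, `ι(u + v√π₀) = (u, π₀v; v, u)` — the
four entry identities of the `hMars` binder with `U = (1, x₁)`, `W = (0, η)` (columns swapped in the other case).  COROLLARY: ★ PART 2 with `hMars` discharged.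

References: [Flicker1998UnitaryFL] Y. Z. Flicker, Canad. J. Math. 50 (1998), Prop. 6 p. 83, REMARK p. 84 · [Serre1979] J.-P. Serre, *Local Fields*, GTM 67,
Ch. II §3 · [Rogawski1990] J. D. Rogawski, Ann. of Math. Stud. 123, §4.9 p. 55. -/

set_option autoImplicit false

open Matrix
open scoped MatrixGroups WithZero

namespace Literature.NumberTheory.Automorphic.UnitaryGroup

open Literature.NumberTheory.Automorphic.HermitianLattice (unitaryInt LocalConjDatum)

universe u

/-! ## §1 The norm form `x² − π₀y²` in `ℤᵐ⁰`-valuations -/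

section Norm

variable {K : Type*} [Field K] [Valued K ℤᵐ⁰] {π₀ : K} (hvπ₀ : Valued.v π₀ = WithZero.exp (-1 : ℤ))

/-- `x² ≤ 1 ⇒ x ≤ 1` in `ℤᵐ⁰`. [cite: Serre1979, Ch. II §3] -/
private theorem le_one_of_sq_le_one' {x : ℤᵐ⁰} (h : x ^ 2 ≤ 1) : x ≤ 1 := by
  by_cases hx : x = 0
  · rw [hx]; exact zero_le
  rw [← WithZero.exp_log hx, ← WithZero.exp_nsmul, ← WithZero.exp_zero, WithZero.exp_le_exp] at h
  rw [← WithZero.exp_log hx, ← WithZero.exp_zero, WithZero.exp_le_exp]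
  simp only [nsmul_eq_mul] at h; push_cast at h; omega

/-- `exp(−1)·y² ≤ 1 ⇒ y ≤ 1` in `ℤᵐ⁰` (discreteness). [cite: Serre1979, Ch. II §3] -/
private theorem le_one_of_exp_mul_sq_le_one' {y : ℤᵐ⁰} (h : WithZero.exp (-1 : ℤ) * y ^ 2 ≤ 1) : y ≤ 1 := by
  by_cases hy : y = 0
  · rw [hy]; exact zero_le
  rw [← WithZero.exp_log hy, ← WithZero.exp_nsmul, ← WithZero.exp_add, ← WithZero.exp_zero, WithZero.exp_le_exp] at h
  rw [← WithZero.exp_log hy, ← WithZero.exp_zero, WithZero.exp_le_exp]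
  simp only [nsmul_eq_mul] at h; push_cast at h; omega

include hvπ₀ in
/-- **`|x² − π₀y²| = max(|x|², |π₀|·|y|²)`** — the valuations of `x²` (even) and `π₀y²` (odd) never coincide. [cite: Flicker1998UnitaryFL, Prop. 6 p. 83] -/
theorem v_sq_sub_mul_sq_eq_max (x y : K) :
    Valued.v (x ^ 2 - π₀ * y ^ 2) = max (Valued.v x ^ 2) (WithZero.exp (-1 : ℤ) * Valued.v y ^ 2) := by
  by_cases hy : y = 0
  · rw [hy]; simp
  by_cases hx : x = 0
  · rw [hx]; simp [hvπ₀]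
  have hvx : Valued.v x ≠ 0 := (Valuation.ne_zero_iff _).2 hx
  have hvy : Valued.v y ≠ 0 := (Valuation.ne_zero_iff _).2 hy
  have hne : Valued.v (x ^ 2) ≠ Valued.v (-(π₀ * y ^ 2)) := by
    rw [Valuation.map_neg, map_pow, map_mul, map_pow, hvπ₀, ← WithZero.exp_log hvx, ← WithZero.exp_log hvy]
    simp only [← WithZero.exp_nsmul, ← WithZero.exp_add, nsmul_eq_mul]
    intro h
    have h' := WithZero.exp_injective h
    omega
  rw [sub_eq_add_neg, Valuation.map_add_of_distinct_val _ hne, Valuation.map_neg, map_pow, map_mul, map_pow, hvπ₀]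

include hvπ₀ in
/-- `x² − π₀y² = 0` only at `(0, 0)`. [cite: Flicker1998UnitaryFL, Prop. 6 p. 83] -/
theorem eq_zero_of_sq_sub_mul_sq_eq_zero {x y : K} (h : x ^ 2 - π₀ * y ^ 2 = 0) : x = 0 ∧ y = 0 := by
  have h1 := v_sq_sub_mul_sq_eq_max hvπ₀ x y
  rw [h, map_zero] at h1
  have h2 := max_le_iff.1 h1.symm.le
  refine ⟨?_, ?_⟩
  · have := le_antisymm h2.1 zero_le
    rwa [pow_eq_zero_iff two_ne_zero, map_eq_zero] at this
  · have := le_antisymm h2.2 zero_le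
    rw [mul_eq_zero] at this
    rcases this with h0 | h0
    · exact absurd h0 WithZero.coe_ne_zero
    · rwa [pow_eq_zero_iff two_ne_zero, map_eq_zero] at h0

include hvπ₀ in
/-- **One column of larger norm divides the other**: if `|N(b,e)| ≤ |N(a,c)|`, `N(a,c) ≠ 0` and `ae − bc ≠ 0`, then with `x₁ = (ab − π₀ce)∕N(a,c)` and
`(ae − bc)∕N(a,c) = π₀^i·η`, `|x₁| ≤ 1`, `|η| = 1`: `b = a x₁ + π₀ c (π₀^i η)` and `e = c x₁ + a (π₀^i η)` (`z₁ = z₀ · (x₁ + π₀^iη√π₀)`; BRAHMAGUPTA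
`N(z₁∕z₀) = N(z₁)∕N(z₀)`). [cite: Flicker1998UnitaryFL, Prop. 6 p. 83] -/
theorem exists_coords_of_v_norm_le {a b c e : K} (hle : Valued.v (b ^ 2 - π₀ * e ^ 2) ≤ Valued.v (a ^ 2 - π₀ * c ^ 2))
    (hN : a ^ 2 - π₀ * c ^ 2 ≠ 0) (hdet : a * e - b * c ≠ 0) :
    ∃ (x₁ η : K) (i : ℕ), Valued.v x₁ ≤ 1 ∧ Valued.v η = 1 ∧
      b = a * x₁ + π₀ * c * (π₀ ^ i * η) ∧ e = c * x₁ + a * (π₀ ^ i * η) := by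
  have hπ₀0 : π₀ ≠ 0 := fun h0 => by rw [h0, map_zero] at hvπ₀; exact WithZero.zero_ne_coe hvπ₀
  set x₁ : K := (a * b - π₀ * c * e) / (a ^ 2 - π₀ * c ^ 2) with hx₁
  set y₁ : K := (a * e - b * c) / (a ^ 2 - π₀ * c ^ 2) with hy₁
  have hbrah : x₁ ^ 2 - π₀ * y₁ ^ 2 = (b ^ 2 - π₀ * e ^ 2) / (a ^ 2 - π₀ * c ^ 2) := by
    rw [hx₁, hy₁]; field_simp; ring
  have hvN0 : Valued.v (a ^ 2 - π₀ * c ^ 2) ≠ 0 := (Valuation.ne_zero_iff _).2 hN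
  have hw : Valued.v (x₁ ^ 2 - π₀ * y₁ ^ 2) ≤ 1 := by
    rw [hbrah, map_div₀]; exact div_le_one_of_le₀ hle zero_le
  rw [v_sq_sub_mul_sq_eq_max hvπ₀, max_le_iff] at hw
  have hvx₁ : Valued.v x₁ ≤ 1 := le_one_of_sq_le_one' hw.1
  have hvy₁ : Valued.v y₁ ≤ 1 := le_one_of_exp_mul_sq_le_one' hw.2
  have hy₁0 : y₁ ≠ 0 := by rw [hy₁]; exact div_ne_zero hdet hN
  have hvy₁0 : Valued.v y₁ ≠ 0 := (Valuation.ne_zero_iff _).2 hy₁0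
  -- `y₁ = π₀^i η`
  obtain ⟨i, hi⟩ : ∃ i : ℕ, Valued.v y₁ = WithZero.exp (-(i : ℤ)) := by
    have hm : Valued.v y₁ = WithZero.exp (WithZero.log (Valued.v y₁)) := (WithZero.exp_log hvy₁0).symm
    have h0 : WithZero.log (Valued.v y₁) ≤ 0 := by
      rw [hm, ← WithZero.exp_zero, WithZero.exp_le_exp] at hvy₁; exact hvy₁
    refine ⟨(-WithZero.log (Valued.v y₁)).toNat, ?_⟩
    rw [Int.toNat_of_nonneg (by omega : (0 : ℤ) ≤ -WithZero.log (Valued.v y₁)), neg_neg]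
    exact hm
  refine ⟨x₁, y₁ / π₀ ^ i, i, hvx₁, ?_, ?_, ?_⟩
  · rw [map_div₀, map_pow, hvπ₀, hi, ← WithZero.exp_nsmul, nsmul_eq_mul, mul_neg, mul_one, div_self WithZero.coe_ne_zero]
  · rw [mul_div_cancel₀ _ (pow_ne_zero _ hπ₀0), hx₁, hy₁, ← mul_div_assoc, ← mul_div_assoc, ← add_div, eq_div_iff hN]; ring
  · rw [mul_div_cancel₀ _ (pow_ne_zero _ hπ₀0), hx₁, hy₁, ← mul_div_assoc, ← mul_div_assoc, ← add_div, eq_div_iff hN]; ring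

include hvπ₀ in
/-- **MARS' LEMMA FOR THE RAMIFIED ORDER `𝒪_F[√π₀]`, READ IN `K`** (the `hMars` binder of ★ `exists_mem_centralizer_mul_ramifiedRep_mul_mem_flickerKH`, VERBATIM as
a term; the integrality premise of the binder is not even needed): every `σ`-fixed `G ∈ M₂(K)` with `G₀₀G₁₁ − G₀₁G₁₀ ≠ 0` is ENTRYWISE `ι(z)·diag(1, π₀^i)·k₀` — `G₀ₖ = uUₖ + π₀v(π₀^iWₖ)`, `G₁ₖ = vUₖ + u(π₀^iWₖ)`
with `σu = u`, `σv = v`, `Uₖ, Wₖ` integral and `|U₀W₁ − U₁W₀| = 1` (Flicker: `GL(2,F) = ⋃_j T₁ r_j K`, proof by the column of minimal valuation).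
[cite: Flicker1998UnitaryFL, Prop. 6 p. 83] -/
theorem exists_ramifiedMars_coords (σ : K →+* K) (G : Matrix (Fin 2) (Fin 2) K) (hG : ∀ a b, σ (G a b) = G a b)
    (hdet : G 0 0 * G 1 1 - G 0 1 * G 1 0 ≠ 0) :
    ∃ (u v : K) (i : ℕ) (U₀ U₁ W₀ W₁ : K), σ u = u ∧ σ v = v ∧
      Valued.v U₀ ≤ 1 ∧ Valued.v U₁ ≤ 1 ∧ Valued.v W₀ ≤ 1 ∧ Valued.v W₁ ≤ 1 ∧ Valued.v (U₀ * W₁ - U₁ * W₀) = 1 ∧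
      G 0 0 = u * U₀ + π₀ * v * (π₀ ^ i * W₀) ∧ G 1 0 = v * U₀ + u * (π₀ ^ i * W₀) ∧
      G 0 1 = u * U₁ + π₀ * v * (π₀ ^ i * W₁) ∧ G 1 1 = v * U₁ + u * (π₀ ^ i * W₁) := by
  rcases le_or_gt (Valued.v (G 0 1 ^ 2 - π₀ * G 1 1 ^ 2)) (Valued.v (G 0 0 ^ 2 - π₀ * G 1 0 ^ 2)) with hle | hlt
  · -- `z = ` the first column
    have hN : G 0 0 ^ 2 - π₀ * G 1 0 ^ 2 ≠ 0 := by
      intro h0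
      obtain ⟨h1, h2⟩ := eq_zero_of_sq_sub_mul_sq_eq_zero hvπ₀ h0
      apply hdet; rw [h1, h2]; ring
    obtain ⟨x₁, η, i, hx₁, hη, hb, he⟩ := exists_coords_of_v_norm_le hvπ₀ hle hN hdet
    refine ⟨G 0 0, G 1 0, i, 1, x₁, 0, η, hG 0 0, hG 1 0, by rw [map_one], hx₁, by rw [map_zero]; exact zero_le, hη.le, ?_, ?_, ?_, ?_, ?_⟩
    · rw [one_mul, mul_zero, sub_zero, hη]
    · ring
    · ring
    · rw [hb]
    · rw [he]
  · -- `z = ` the second column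
    have hN : G 0 1 ^ 2 - π₀ * G 1 1 ^ 2 ≠ 0 := by
      intro h0
      obtain ⟨h1, h2⟩ := eq_zero_of_sq_sub_mul_sq_eq_zero hvπ₀ h0
      apply hdet; rw [h1, h2]; ring
    have hdet' : G 0 1 * G 1 0 - G 0 0 * G 1 1 ≠ 0 := fun h0 => hdet (by linear_combination (-1 : K) * h0)
    obtain ⟨x₁, η, i, hx₁, hη, ha, hc⟩ := exists_coords_of_v_norm_le hvπ₀ hlt.le hN hdet'
    refine ⟨G 0 1, G 1 1, i, x₁, 1, η, 0, hG 0 1, hG 1 1, hx₁, by rw [map_one], hη.le, by rw [map_zero]; exact zero_le, ?_, ?_, ?_, ?_, ?_⟩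
    · rw [mul_zero, one_mul, zero_sub, Valuation.map_neg, hη]
    · rw [ha]
    · rw [hc]
    · ring
    · ring

end Norm

/-! ## §2 Flicker's Prop. 6 (a) for the type-(2) torus, `hMars` discharged -/

section Main

variable {K : Type*} [Field K] [Valued K ℤᵐ⁰] {ϖ : K} (σ : K →+* K) {J : Matrix (Fin 3) (Fin 3) K}
  (hJ : J = (StdForm.antidiagonal 3).over K) (hd : LocalConjDatum σ ϖ)

include hJ hd in
/-- **FLICKER'S PROPOSITION 6 (a), RAMIFIED TORUS — `H = ⋃_n T_H · r_n · K_H`, UNCONDITIONAL** (★ PART 2 `exists_mem_centralizer_mul_ramifiedRep_mul_mem_flickerKH` with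
its `hMars` binder discharged by `exists_ramifiedMars_coords`; remaining hypotheses: the bridge `(R, ι, σR, dR)` with `R` complete for `𝔪`, `|ρ| = |ϖ|`, the torus
block `t′` and the representatives `r`). [cite: Flicker1998UnitaryFL, Prop. 6 p. 83; REMARK p. 84] [cite: Serre1979, Ch. V §2 Prop. 3] -/
theorem exists_mem_centralizer_mul_ramifiedRep_mul_mem_flickerKH'
    {R : Type u} [CommRing R] [IsDomain R] [IsDiscreteValuationRing R] [IsAdicComplete (IsLocalRing.maximalIdeal R) R]
    (ι : R →+* K) (hι : Function.Injective ι)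
    (hιv : ∀ x : K, Valued.v x ≤ 1 ↔ x ∈ Set.range ι) (σR : R →+* R) (hσR : ∀ r, σR (σR r) = r) (hσι : ∀ r, ι (σR r) = σ (ι r))
    {dR : R} (hdRσ : σR dR = -dR) (hdRu : IsUnit dR) (h2R : IsUnit (2 : R))
    {c : ↥(unitaryGroupOfForm σ J)} (hc : ((c : GL (Fin 3) K) : Matrix (Fin 3) (Fin 3) K) = !![1, 0, 0; 0, -1, 0; 0, 0, 1])
    {ρ : K} (hρ : Valued.v ρ = Valued.v ϖ)
    {t : ↥(unitaryGroupOfForm σ J)} (htH : t ∈ Subgroup.centralizer ({c} : Set ↥(unitaryGroupOfForm σ J))) {A B C b₀ : K}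
    (hte : ((t : GL (Fin 3) K) : Matrix (Fin 3) (Fin 3) K) = !![A, 0, B; 0, b₀, 0; C, 0, A]) (hC : C ≠ 0) (hBC : B = C * ρ)
    (r : ℕ → ↥(Subgroup.centralizer ({c} : Set ↥(unitaryGroupOfForm σ J))))
    (hr0 : ∀ a : ℕ, (((r (2 * a) : ↥(unitaryGroupOfForm σ J)) : GL (Fin 3) K) : Matrix (Fin 3) (Fin 3) K) = !![(ϖ ^ a)⁻¹, 0, 0; 0, 1, 0; 0, 0, ϖ ^ a])
    (hr1 : ∀ a : ℕ, (((r (2 * a + 1) : ↥(unitaryGroupOfForm σ J)) : GL (Fin 3) K) : Matrix (Fin 3) (Fin 3) K) =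
      !![0, 0, ϖ ^ (a + 1) / ι dR; 0, 1, 0; -ι dR * (ϖ ^ (a + 1))⁻¹, 0, 0])
    (g : ↥(Subgroup.centralizer ({c} : Set ↥(unitaryGroupOfForm σ J)))) :
    ∃ n : ℕ, ∃ τ ∈ Subgroup.centralizer ({⟨t, htH⟩} : Set ↥(Subgroup.centralizer ({c} : Set ↥(unitaryGroupOfForm σ J)))),
      ∃ k ∈ (flickerKH σ J c).subgroupOf (Subgroup.centralizer ({c} : Set ↥(unitaryGroupOfForm σ J))), g = τ * r n * k := by
  have hvd : Valued.v (ι dR) = 1 := TorusBridge.v_eq_one_of_isUnit ι hιv hdRu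
  have hvπ₀ : Valued.v (ι dR ^ 2 * ρ) = WithZero.exp (-1 : ℤ) := by rw [map_mul, map_pow, hvd, one_pow, one_mul, hρ, hd.vϖ]
  exact exists_mem_centralizer_mul_ramifiedRep_mul_mem_flickerKH σ hJ hd ι hι hιv σR hσR hσι hdRσ hdRu h2R hc hρ rfl
    (fun G hG _ hdet => exists_ramifiedMars_coords hvπ₀ σ G hG hdet) htH hte hC hBC r hr0 hr1 g

end Main

end Literature.NumberTheory.Automorphic.UnitaryGroup
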